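import Summits.HubbardSuperconductivity.HubbardSuperconductivity.Theorems.NodalDiracTwistNodalDiracWeakCouplingOfConicalQuartet
import Summits.HubbardSuperconductivity.HubbardSuperconductivity.Theorems.NodalDiracTwistNodalDiracWeakCouplingRotCovariance
import Summits.HubbardSuperconductivity.HubbardSuperconductivity.Theorems.NodalDiracTwistNodalDiracWeakCouplingReflCovariance
import Summits.HubbardSuperconductivity.HubbardSuperconductivity.Theorems.NodalDiracTwistNodalDiracWeakCouplingSectorTransport

/-!
# The `D₄` reduction of the conical quartet to one point (crux `NodalDiracWeakCoupling`, line `birth`)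

Route `HubbardSuperconductivity/NodalDiracTwist`, crux stmt-HubbardSuperconductivity-10370, skeleton
`Cruxes/NodalDiracWeakCoupling/Lines/birth.lean` v6. The point group `D₄` of the square torus acts
on Fock space by signed permutations and the spin-twisted Hubbard torus `H_L(U, φ)` is covariant,
`Γ_γ H_L(U, φ) Γ_γ⁻¹ = H_L(U, γ·φ)`, for the linear action of `D₄` on twists (generators landed as
`stub_rotCovariance`, `stub_reflCovariance`). This file proves:

* the derived covariances `rot2Covariance` (`φ ↦ -φ`), `neg0Covariance` (`sr 2`: `φ ↦ (-φ₀, φ₁)`),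
  `swapCovariance` (`sr 3`: `φ ↦ (φ₁, φ₀)`);
* the model transport lemmas: the degeneracy predicate of the `(N, S^z = 0)` sector ground state
  of `H_L(U, φ)` is invariant under `φ_μ ↦ -φ_μ` and under the swap (`deg_neg0_iff`,
  `deg_neg1_iff`, `deg_swap_iff`, `deg_abs_iff`), and the exactly-two-fold property and the cone
  inequality are transported by the reflections (`twofold_neg0/1`, `cone_neg0/1`);
* **`conicalQuartet_of_core`**: the ONE-POINT form of the physics stub (LOCUS on the triangle
  `0 ≤ φ₁ ≤ φ₀ ≤ π`, exactly-two-fold cone at the single twist `(c, c)`) implies the QUARTET form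
  (LOCUS on the cell `(-π, π]²`, two-fold cones at all four `(±c, ±c)`) — the two are equivalent;
* **`nodalDiracWeakCoupling_of_conicalCore`**: the one-point form implies the crux
  (`nodalDiracWeakCoupling_of_conicalQuartet ∘ conicalQuartet_of_core`).

## References

D. J. Scalapino, Phys. Rep. 250 (1995) 329, §2 (point group of the square lattice); S. Karakuzu,
K. Seki, S. Sorella, PRB 98 (2018) 075156, Sec. II D (twisted boundary conditions); O. Bratteli,
D. W. Robinson, *Operator Algebras and Quantum Statistical Mechanics II* (1997), §5.2.2.
-/

-- the mandated namespace repeats `HubbardSuperconductivity` (single-problem summit, D-0017)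
set_option linter.dupNamespace false

noncomputable section

namespace Summit.HubbardSuperconductivity.HubbardSuperconductivity.Theorems.NodalDiracTwist

open Literature.MathematicalPhysics.QuantumLattice Literature.Probability.LatticeModels Matrix
open Summit.HubbardSuperconductivity.HubbardSuperconductivity.Theses.NodalDiracTwist

/-! ### Derived covariances -/

/-- Covariance under `r 2` (`x ↦ -x`): `Γ H_L(U, φ) Γ⁻¹ = H_L(U, (-φ₀, -φ₁))`.
[cite: Scalapino1995, §2] -/
theorem rot2Covariance (L : ℕ) [NeZero L] (U : ℝ) (φ : Fin 2 → ℝ) :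
    relabel (Orb.d4Perm (L := L) (DihedralGroup.r 2)) (spinTwistedHubbardTorus L U φ) =
      spinTwistedHubbardTorus L U ![-φ 0, -φ 1] := by
  have h2 : (DihedralGroup.r 2 : DihedralGroup 4) = DihedralGroup.r 1 * DihedralGroup.r 1 := by
    rw [DihedralGroup.r_mul_r]; rfl
  rw [h2, map_mul, relabel_perm_mul, stub_rotCovariance, stub_rotCovariance]
  rfl

/-- **Covariance under `sr 2`** (site map `(x₀, x₁) ↦ (-x₀, x₁)`): `Γ H_L(U, φ) Γ⁻¹ = H_L(U, (-φ₀, φ₁))`.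
[cite: Scalapino1995, §2] -/
theorem neg0Covariance (L : ℕ) [NeZero L] (U : ℝ) (φ : Fin 2 → ℝ) :
    relabel (Orb.d4Perm (L := L) (DihedralGroup.sr 2)) (spinTwistedHubbardTorus L U φ) =
      spinTwistedHubbardTorus L U ![-φ 0, φ 1] := by
  have h2 : (DihedralGroup.sr 2 : DihedralGroup 4) = DihedralGroup.sr 0 * DihedralGroup.r 2 := by
    rw [DihedralGroup.sr_mul_r]; rfl
  rw [h2, map_mul, relabel_perm_mul, rot2Covariance, stub_reflCovariance]
  congr 1
  funext i
  fin_cases i <;> simp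

/-- **Covariance under `sr 3`** (the swap `(x₀, x₁) ↦ (x₁, x₀)`): `Γ H_L(U, φ) Γ⁻¹ = H_L(U, (φ₁, φ₀))`.
[cite: Scalapino1995, §2] -/
theorem swapCovariance (L : ℕ) [NeZero L] (U : ℝ) (φ : Fin 2 → ℝ) :
    relabel (Orb.d4Perm (L := L) (DihedralGroup.sr 3)) (spinTwistedHubbardTorus L U φ) =
      spinTwistedHubbardTorus L U ![φ 1, φ 0] := by
  have h3 : (DihedralGroup.sr 3 : DihedralGroup 4) =
      DihedralGroup.sr 0 * (DihedralGroup.r 1 * DihedralGroup.r 2) := by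
    rw [DihedralGroup.r_mul_r, DihedralGroup.sr_mul_r]; rfl
  rw [h3, map_mul, map_mul, relabel_perm_mul, relabel_perm_mul, rot2Covariance, stub_rotCovariance,
    stub_reflCovariance]
  congr 1
  funext i
  fin_cases i <;> simp

/-! ### Model transport lemmas for the spin-twisted torus (fixed `L, U, N`) -/

section Model

variable (L : ℕ) [NeZero L] (U : ℝ) (N : ℕ)

/-- Degeneracy of the sector ground state is invariant under `φ₀ ↦ -φ₀`. [folklore] -/
theorem deg_neg0_iff (φ : Fin 2 → ℝ) :
    (∃ ψ₁ ψ₂ : Fock (Orb (FermionTorus 2 L)),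
        IsGroundStateInSector (spinTwistedHubbardTorus L U ![-φ 0, φ 1]) N 0 ψ₁ ∧
        IsGroundStateInSector (spinTwistedHubbardTorus L U ![-φ 0, φ 1]) N 0 ψ₂ ∧ star ψ₁ ⬝ᵥ ψ₂ = 0) ↔
    (∃ ψ₁ ψ₂ : Fock (Orb (FermionTorus 2 L)),
        IsGroundStateInSector (spinTwistedHubbardTorus L U φ) N 0 ψ₁ ∧
        IsGroundStateInSector (spinTwistedHubbardTorus L U φ) N 0 ψ₂ ∧ star ψ₁ ⬝ᵥ ψ₂ = 0) := by
  rw [← neg0Covariance L U φ, Orb.d4Perm_eq_mapEquiv]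
  exact deg_relabel_iff _ _ _ _

/-- Degeneracy of the sector ground state is invariant under `φ₁ ↦ -φ₁`. [folklore] -/
theorem deg_neg1_iff (φ : Fin 2 → ℝ) :
    (∃ ψ₁ ψ₂ : Fock (Orb (FermionTorus 2 L)),
        IsGroundStateInSector (spinTwistedHubbardTorus L U ![φ 0, -φ 1]) N 0 ψ₁ ∧
        IsGroundStateInSector (spinTwistedHubbardTorus L U ![φ 0, -φ 1]) N 0 ψ₂ ∧ star ψ₁ ⬝ᵥ ψ₂ = 0) ↔
    (∃ ψ₁ ψ₂ : Fock (Orb (FermionTorus 2 L)),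
        IsGroundStateInSector (spinTwistedHubbardTorus L U φ) N 0 ψ₁ ∧
        IsGroundStateInSector (spinTwistedHubbardTorus L U φ) N 0 ψ₂ ∧ star ψ₁ ⬝ᵥ ψ₂ = 0) := by
  rw [← stub_reflCovariance L U φ, Orb.d4Perm_eq_mapEquiv]
  exact deg_relabel_iff _ _ _ _

/-- Degeneracy of the sector ground state is invariant under the swap `(φ₀, φ₁) ↦ (φ₁, φ₀)`.
[folklore] -/
theorem deg_swap_iff (φ : Fin 2 → ℝ) :
    (∃ ψ₁ ψ₂ : Fock (Orb (FermionTorus 2 L)),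
        IsGroundStateInSector (spinTwistedHubbardTorus L U ![φ 1, φ 0]) N 0 ψ₁ ∧
        IsGroundStateInSector (spinTwistedHubbardTorus L U ![φ 1, φ 0]) N 0 ψ₂ ∧ star ψ₁ ⬝ᵥ ψ₂ = 0) ↔
    (∃ ψ₁ ψ₂ : Fock (Orb (FermionTorus 2 L)),
        IsGroundStateInSector (spinTwistedHubbardTorus L U φ) N 0 ψ₁ ∧
        IsGroundStateInSector (spinTwistedHubbardTorus L U φ) N 0 ψ₂ ∧ star ψ₁ ⬝ᵥ ψ₂ = 0) := by
  rw [← swapCovariance L U φ, Orb.d4Perm_eq_mapEquiv]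
  exact deg_relabel_iff _ _ _ _

/-- Degeneracy of the sector ground state depends only on `(|φ₀|, |φ₁|)`. [folklore] -/
theorem deg_abs_iff (φ : Fin 2 → ℝ) :
    (∃ ψ₁ ψ₂ : Fock (Orb (FermionTorus 2 L)),
        IsGroundStateInSector (spinTwistedHubbardTorus L U ![|φ 0|, |φ 1|]) N 0 ψ₁ ∧
        IsGroundStateInSector (spinTwistedHubbardTorus L U ![|φ 0|, |φ 1|]) N 0 ψ₂ ∧ star ψ₁ ⬝ᵥ ψ₂ = 0) ↔
    (∃ ψ₁ ψ₂ : Fock (Orb (FermionTorus 2 L)),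
        IsGroundStateInSector (spinTwistedHubbardTorus L U φ) N 0 ψ₁ ∧
        IsGroundStateInSector (spinTwistedHubbardTorus L U φ) N 0 ψ₂ ∧ star ψ₁ ⬝ᵥ ψ₂ = 0) := by
  rcases le_or_gt 0 (φ 0) with h0 | h0 <;> rcases le_or_gt 0 (φ 1) with h1 | h1
  · rw [abs_of_nonneg h0, abs_of_nonneg h1, twist_vec2_eta]
  · rw [abs_of_nonneg h0, abs_of_neg h1]
    exact deg_neg1_iff L U N φ
  · rw [abs_of_neg h0, abs_of_nonneg h1]
    exact deg_neg0_iff L U N φ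
  · rw [abs_of_neg h0, abs_of_neg h1]
    have hA := deg_neg0_iff L U N ![φ 0, -φ 1]
    simp only [Matrix.cons_val_zero, Matrix.cons_val_one] at hA
    exact hA.trans (deg_neg1_iff L U N φ)

/-- Transport of the exactly-two-fold property under `φ₀ ↦ -φ₀`. [folklore] -/
theorem twofold_neg0 (p : Fin 2 → ℝ)
    (h : ∃ ψ₁ ψ₂ : Fock (Orb (FermionTorus 2 L)),
        IsGroundStateInSector (spinTwistedHubbardTorus L U p) N 0 ψ₁ ∧
        IsGroundStateInSector (spinTwistedHubbardTorus L U p) N 0 ψ₂ ∧ star ψ₁ ⬝ᵥ ψ₂ = 0 ∧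
        ∀ χ : Fock (Orb (FermionTorus 2 L)), IsGroundStateInSector (spinTwistedHubbardTorus L U p) N 0 χ →
          ∃ z₁ z₂ : ℂ, χ = z₁ • ψ₁ + z₂ • ψ₂) :
    ∃ ψ₁ ψ₂ : Fock (Orb (FermionTorus 2 L)),
        IsGroundStateInSector (spinTwistedHubbardTorus L U ![-p 0, p 1]) N 0 ψ₁ ∧
        IsGroundStateInSector (spinTwistedHubbardTorus L U ![-p 0, p 1]) N 0 ψ₂ ∧ star ψ₁ ⬝ᵥ ψ₂ = 0 ∧
        ∀ χ : Fock (Orb (FermionTorus 2 L)),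
          IsGroundStateInSector (spinTwistedHubbardTorus L U ![-p 0, p 1]) N 0 χ →
            ∃ z₁ z₂ : ℂ, χ = z₁ • ψ₁ + z₂ • ψ₂ := by
  rw [← neg0Covariance L U p, Orb.d4Perm_eq_mapEquiv]
  exact twofold_relabel _ h

/-- Transport of the exactly-two-fold property under `φ₁ ↦ -φ₁`. [folklore] -/
theorem twofold_neg1 (p : Fin 2 → ℝ)
    (h : ∃ ψ₁ ψ₂ : Fock (Orb (FermionTorus 2 L)),
        IsGroundStateInSector (spinTwistedHubbardTorus L U p) N 0 ψ₁ ∧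
        IsGroundStateInSector (spinTwistedHubbardTorus L U p) N 0 ψ₂ ∧ star ψ₁ ⬝ᵥ ψ₂ = 0 ∧
        ∀ χ : Fock (Orb (FermionTorus 2 L)), IsGroundStateInSector (spinTwistedHubbardTorus L U p) N 0 χ →
          ∃ z₁ z₂ : ℂ, χ = z₁ • ψ₁ + z₂ • ψ₂) :
    ∃ ψ₁ ψ₂ : Fock (Orb (FermionTorus 2 L)),
        IsGroundStateInSector (spinTwistedHubbardTorus L U ![p 0, -p 1]) N 0 ψ₁ ∧
        IsGroundStateInSector (spinTwistedHubbardTorus L U ![p 0, -p 1]) N 0 ψ₂ ∧ star ψ₁ ⬝ᵥ ψ₂ = 0 ∧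
        ∀ χ : Fock (Orb (FermionTorus 2 L)),
          IsGroundStateInSector (spinTwistedHubbardTorus L U ![p 0, -p 1]) N 0 χ →
            ∃ z₁ z₂ : ℂ, χ = z₁ • ψ₁ + z₂ • ψ₂ := by
  rw [← stub_reflCovariance L U p, Orb.d4Perm_eq_mapEquiv]
  exact twofold_relabel _ h

/-- Transport of the cone inequality under `φ₀ ↦ -φ₀` (an involutive isometry of twist space
implemented by `sr 2`). [folklore] -/
theorem cone_neg0 (p : Fin 2 → ℝ)
    (h : ∃ m : ℝ, 0 < m ∧ ∃ ρ : ℝ, 0 < ρ ∧ ∀ φ : Fin 2 → ℝ,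
        0 < (φ 0 - p 0) ^ 2 + (φ 1 - p 1) ^ 2 → (φ 0 - p 0) ^ 2 + (φ 1 - p 1) ^ 2 ≤ ρ ^ 2 →
        ∀ ψ χ : Fock (Orb (FermionTorus 2 L)),
          IsGroundStateInSector (spinTwistedHubbardTorus L U φ) N 0 ψ → χ ∈ szSector N 0 →
          star ψ ⬝ᵥ χ = 0 → star χ ⬝ᵥ χ = 1 →
            Matrix.minEnergyOn (spinTwistedHubbardTorus L U φ) (szSector N 0) +
                m * Real.sqrt ((φ 0 - p 0) ^ 2 + (φ 1 - p 1) ^ 2) ≤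
              (star χ ⬝ᵥ (spinTwistedHubbardTorus L U φ *ᵥ χ)).re) :
    ∃ m : ℝ, 0 < m ∧ ∃ ρ : ℝ, 0 < ρ ∧ ∀ φ : Fin 2 → ℝ,
        0 < (φ 0 - (![-p 0, p 1] : Fin 2 → ℝ) 0) ^ 2 + (φ 1 - (![-p 0, p 1] : Fin 2 → ℝ) 1) ^ 2 →
        (φ 0 - (![-p 0, p 1] : Fin 2 → ℝ) 0) ^ 2 + (φ 1 - (![-p 0, p 1] : Fin 2 → ℝ) 1) ^ 2 ≤ ρ ^ 2 →
        ∀ ψ χ : Fock (Orb (FermionTorus 2 L)),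
          IsGroundStateInSector (spinTwistedHubbardTorus L U φ) N 0 ψ → χ ∈ szSector N 0 →
          star ψ ⬝ᵥ χ = 0 → star χ ⬝ᵥ χ = 1 →
            Matrix.minEnergyOn (spinTwistedHubbardTorus L U φ) (szSector N 0) +
                m * Real.sqrt ((φ 0 - (![-p 0, p 1] : Fin 2 → ℝ) 0) ^ 2 +
                  (φ 1 - (![-p 0, p 1] : Fin 2 → ℝ) 1) ^ 2) ≤
              (star χ ⬝ᵥ (spinTwistedHubbardTorus L U φ *ᵥ χ)).re :=
  cone_transport (FermionTorus.ofTorusEquiv (d4SitePerm (DihedralGroup.sr 2)))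
    (spinTwistedHubbardTorus L U) (fun φ => ![-φ 0, φ 1])
    (fun φ => by rw [← Orb.d4Perm_eq_mapEquiv]; exact neg0Covariance L U φ)
    (fun φ => by funext i; fin_cases i <;> simp)
    (fun φ q => by simp only [Matrix.cons_val_zero, Matrix.cons_val_one]; ring)
    N 0 p h

/-- Transport of the cone inequality under `φ₁ ↦ -φ₁` (implemented by `sr 0`). [folklore] -/
theorem cone_neg1 (p : Fin 2 → ℝ)
    (h : ∃ m : ℝ, 0 < m ∧ ∃ ρ : ℝ, 0 < ρ ∧ ∀ φ : Fin 2 → ℝ,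
        0 < (φ 0 - p 0) ^ 2 + (φ 1 - p 1) ^ 2 → (φ 0 - p 0) ^ 2 + (φ 1 - p 1) ^ 2 ≤ ρ ^ 2 →
        ∀ ψ χ : Fock (Orb (FermionTorus 2 L)),
          IsGroundStateInSector (spinTwistedHubbardTorus L U φ) N 0 ψ → χ ∈ szSector N 0 →
          star ψ ⬝ᵥ χ = 0 → star χ ⬝ᵥ χ = 1 →
            Matrix.minEnergyOn (spinTwistedHubbardTorus L U φ) (szSector N 0) +
                m * Real.sqrt ((φ 0 - p 0) ^ 2 + (φ 1 - p 1) ^ 2) ≤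
              (star χ ⬝ᵥ (spinTwistedHubbardTorus L U φ *ᵥ χ)).re) :
    ∃ m : ℝ, 0 < m ∧ ∃ ρ : ℝ, 0 < ρ ∧ ∀ φ : Fin 2 → ℝ,
        0 < (φ 0 - (![p 0, -p 1] : Fin 2 → ℝ) 0) ^ 2 + (φ 1 - (![p 0, -p 1] : Fin 2 → ℝ) 1) ^ 2 →
        (φ 0 - (![p 0, -p 1] : Fin 2 → ℝ) 0) ^ 2 + (φ 1 - (![p 0, -p 1] : Fin 2 → ℝ) 1) ^ 2 ≤ ρ ^ 2 →
        ∀ ψ χ : Fock (Orb (FermionTorus 2 L)),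
          IsGroundStateInSector (spinTwistedHubbardTorus L U φ) N 0 ψ → χ ∈ szSector N 0 →
          star ψ ⬝ᵥ χ = 0 → star χ ⬝ᵥ χ = 1 →
            Matrix.minEnergyOn (spinTwistedHubbardTorus L U φ) (szSector N 0) +
                m * Real.sqrt ((φ 0 - (![p 0, -p 1] : Fin 2 → ℝ) 0) ^ 2 +
                  (φ 1 - (![p 0, -p 1] : Fin 2 → ℝ) 1) ^ 2) ≤
              (star χ ⬝ᵥ (spinTwistedHubbardTorus L U φ *ᵥ χ)).re :=
  cone_transport (FermionTorus.ofTorusEquiv (d4SitePerm (DihedralGroup.sr 0)))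
    (spinTwistedHubbardTorus L U) (fun φ => ![φ 0, -φ 1])
    (fun φ => by rw [← Orb.d4Perm_eq_mapEquiv]; exact stub_reflCovariance L U φ)
    (fun φ => by funext i; fin_cases i <;> simp)
    (fun φ q => by simp only [Matrix.cons_val_zero, Matrix.cons_val_one]; ring)
    N 0 p h

end Model

/-! ### The reduction: one-point form ⇒ quartet form ⇒ crux -/

/-- **One-point form ⇒ quartet form** (the `D₄` reduction). LOCUS on the cell `(-π, π]²` from
LOCUS on the triangle `0 ≤ φ₁ ≤ φ₀ ≤ π`: the degeneracy predicate is invariant under `φ_μ ↦ -φ_μ`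
and under the swap, so its value at `φ` is its value at the sorted pair `(max |φ_μ|, min |φ_μ|)`,
which lies in the triangle, and `(max, min) = (c, c)` iff `|φ₀| = |φ₁| = c`. Two-fold cones at the
four points `(±c, ±c)` from the one at `(c, c)`: they are its images under `1`, `sr 0`, `sr 2`,
`sr 2 ∘ sr 0`, which transport the two-fold property and the cone inequality. The converse
implication is trivial (restriction), so the two forms are equivalent. [folklore] -/
theorem conicalQuartet_of_core
    (hcore :
    ∀ U₀ : ℝ, 0 < U₀ → ∃ U ∈ Set.Ioo (0 : ℝ) U₀, ∃ δ ∈ Set.Icc (1 / 10 : ℝ) (3 / 10),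
      ∃ κ : ℝ, 0 < κ ∧ κ < Real.pi ∧ Real.cos κ ≠ 0 ∧ ∀ ε : ℝ, 0 < ε → ∃ L₀ : ℕ,
        ∀ (L : ℕ) [NeZero L], Even L → L₀ ≤ L → (∀ m : ℤ, ε ≤ |L * κ - m * Real.pi|) →
          ∃ c : ℝ, 0 < c ∧ c < Real.pi ∧ |Real.cos c - Real.cos (L * κ)| ≤ ε ∧
            (∀ φ : Fin 2 → ℝ, 0 ≤ φ 1 → φ 1 ≤ φ 0 → φ 0 ≤ Real.pi →
                ((∃ ψ₁ ψ₂ : Fock (Orb (FermionTorus 2 L)),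
                    IsGroundStateInSector (spinTwistedHubbardTorus L U φ) (2 * ⌊(1 - δ) * (L : ℝ) ^ 2 / 2⌋₊) 0 ψ₁ ∧
                    IsGroundStateInSector (spinTwistedHubbardTorus L U φ) (2 * ⌊(1 - δ) * (L : ℝ) ^ 2 / 2⌋₊) 0 ψ₂ ∧
                    star ψ₁ ⬝ᵥ ψ₂ = 0) ↔ (φ 0 = c ∧ φ 1 = c))) ∧
            (∃ ψ₁ ψ₂ : Fock (Orb (FermionTorus 2 L)),
                IsGroundStateInSector (spinTwistedHubbardTorus L U (fun _ : Fin 2 => c)) (2 * ⌊(1 - δ) * (L : ℝ) ^ 2 / 2⌋₊) 0 ψ₁ ∧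
                IsGroundStateInSector (spinTwistedHubbardTorus L U (fun _ : Fin 2 => c)) (2 * ⌊(1 - δ) * (L : ℝ) ^ 2 / 2⌋₊) 0 ψ₂ ∧
                star ψ₁ ⬝ᵥ ψ₂ = 0 ∧
                ∀ χ : Fock (Orb (FermionTorus 2 L)),
                  IsGroundStateInSector (spinTwistedHubbardTorus L U (fun _ : Fin 2 => c)) (2 * ⌊(1 - δ) * (L : ℝ) ^ 2 / 2⌋₊) 0 χ →
                    ∃ z₁ z₂ : ℂ, χ = z₁ • ψ₁ + z₂ • ψ₂) ∧
            (∃ m : ℝ, 0 < m ∧ ∃ ρ : ℝ, 0 < ρ ∧ ∀ φ : Fin 2 → ℝ,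
                0 < (φ 0 - c) ^ 2 + (φ 1 - c) ^ 2 →
                (φ 0 - c) ^ 2 + (φ 1 - c) ^ 2 ≤ ρ ^ 2 →
                ∀ ψ χ : Fock (Orb (FermionTorus 2 L)),
                  IsGroundStateInSector (spinTwistedHubbardTorus L U φ) (2 * ⌊(1 - δ) * (L : ℝ) ^ 2 / 2⌋₊) 0 ψ →
                  χ ∈ szSector (2 * ⌊(1 - δ) * (L : ℝ) ^ 2 / 2⌋₊) 0 → star ψ ⬝ᵥ χ = 0 → star χ ⬝ᵥ χ = 1 →
                    Matrix.minEnergyOn (spinTwistedHubbardTorus L U φ) (szSector (2 * ⌊(1 - δ) * (L : ℝ) ^ 2 / 2⌋₊) 0) +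
                        m * Real.sqrt ((φ 0 - c) ^ 2 + (φ 1 - c) ^ 2) ≤
                      (star χ ⬝ᵥ (spinTwistedHubbardTorus L U φ *ᵥ χ)).re)) :
    ∀ U₀ : ℝ, 0 < U₀ → ∃ U ∈ Set.Ioo (0 : ℝ) U₀, ∃ δ ∈ Set.Icc (1 / 10 : ℝ) (3 / 10),
      ∃ κ : ℝ, 0 < κ ∧ κ < Real.pi ∧ Real.cos κ ≠ 0 ∧ ∀ ε : ℝ, 0 < ε → ∃ L₀ : ℕ,
        ∀ (L : ℕ) [NeZero L], Even L → L₀ ≤ L → (∀ m : ℤ, ε ≤ |L * κ - m * Real.pi|) →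
          ∃ c : ℝ, 0 < c ∧ c < Real.pi ∧ |Real.cos c - Real.cos (L * κ)| ≤ ε ∧
            (∀ φ : Fin 2 → ℝ, φ 0 ∈ Set.Ioc (-Real.pi) Real.pi →
              φ 1 ∈ Set.Ioc (-Real.pi) Real.pi →
                ((∃ ψ₁ ψ₂ : Fock (Orb (FermionTorus 2 L)),
                    IsGroundStateInSector (spinTwistedHubbardTorus L U φ) (2 * ⌊(1 - δ) * (L : ℝ) ^ 2 / 2⌋₊) 0 ψ₁ ∧
                    IsGroundStateInSector (spinTwistedHubbardTorus L U φ) (2 * ⌊(1 - δ) * (L : ℝ) ^ 2 / 2⌋₊) 0 ψ₂ ∧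
                    star ψ₁ ⬝ᵥ ψ₂ = 0) ↔ (|φ 0| = c ∧ |φ 1| = c))) ∧
            (∀ p : Fin 2 → ℝ, |p 0| = c → |p 1| = c →
              (∃ ψ₁ ψ₂ : Fock (Orb (FermionTorus 2 L)),
                  IsGroundStateInSector (spinTwistedHubbardTorus L U p) (2 * ⌊(1 - δ) * (L : ℝ) ^ 2 / 2⌋₊) 0 ψ₁ ∧
                  IsGroundStateInSector (spinTwistedHubbardTorus L U p) (2 * ⌊(1 - δ) * (L : ℝ) ^ 2 / 2⌋₊) 0 ψ₂ ∧
                  star ψ₁ ⬝ᵥ ψ₂ = 0 ∧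
                  ∀ χ : Fock (Orb (FermionTorus 2 L)),
                    IsGroundStateInSector (spinTwistedHubbardTorus L U p) (2 * ⌊(1 - δ) * (L : ℝ) ^ 2 / 2⌋₊) 0 χ →
                      ∃ z₁ z₂ : ℂ, χ = z₁ • ψ₁ + z₂ • ψ₂) ∧
              (∃ m : ℝ, 0 < m ∧ ∃ ρ : ℝ, 0 < ρ ∧ ∀ φ : Fin 2 → ℝ,
                  0 < (φ 0 - p 0) ^ 2 + (φ 1 - p 1) ^ 2 →
                  (φ 0 - p 0) ^ 2 + (φ 1 - p 1) ^ 2 ≤ ρ ^ 2 →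
                  ∀ ψ χ : Fock (Orb (FermionTorus 2 L)),
                    IsGroundStateInSector (spinTwistedHubbardTorus L U φ) (2 * ⌊(1 - δ) * (L : ℝ) ^ 2 / 2⌋₊) 0 ψ →
                    χ ∈ szSector (2 * ⌊(1 - δ) * (L : ℝ) ^ 2 / 2⌋₊) 0 → star ψ ⬝ᵥ χ = 0 → star χ ⬝ᵥ χ = 1 →
                      Matrix.minEnergyOn (spinTwistedHubbardTorus L U φ) (szSector (2 * ⌊(1 - δ) * (L : ℝ) ^ 2 / 2⌋₊) 0) +
                          m * Real.sqrt ((φ 0 - p 0) ^ 2 + (φ 1 - p 1) ^ 2) ≤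
                        (star χ ⬝ᵥ (spinTwistedHubbardTorus L U φ *ᵥ χ)).re)) := by
  intro U₀ hU₀
  obtain ⟨U, hU, δ, hδ, κ, hκ0, hκπ, hcos, hε⟩ := hcore U₀ hU₀
  refine ⟨U, hU, δ, hδ, κ, hκ0, hκπ, hcos, fun ε hε0 => ?_⟩
  obtain ⟨L₀, hL⟩ := hε ε hε0
  refine ⟨L₀, fun L _ hEven hL₀ hres => ?_⟩
  obtain ⟨c, hc0, hcπ, hcc, hlocus, htwo, hcone⟩ := hL L hEven hL₀ hres
  set N : ℕ := 2 * ⌊(1 - δ) * (L : ℝ) ^ 2 / 2⌋₊ with hN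
  refine ⟨c, hc0, hcπ, hcc, fun φ hφ0 hφ1 => ?_, fun p hp0 hp1 => ?_⟩
  · -- LOCUS on the cell from LOCUS on the triangle
    have ha : |φ 0| ≤ Real.pi := abs_le.2 ⟨by linarith [hφ0.1], hφ0.2⟩
    have hb : |φ 1| ≤ Real.pi := abs_le.2 ⟨by linarith [hφ1.1], hφ1.2⟩
    rw [← deg_abs_iff L U N φ]
    rcases le_total (|φ 1|) (|φ 0|) with hle | hle
    · -- already sorted
      have key := hlocus ![|φ 0|, |φ 1|] (by simp) (by simpa using hle) (by simpa using ha)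
      simp only [Matrix.cons_val_zero, Matrix.cons_val_one] at key
      exact key
    · -- swap first
      have hsw := deg_swap_iff L U N ![|φ 0|, |φ 1|]
      simp only [Matrix.cons_val_zero, Matrix.cons_val_one] at hsw
      rw [← hsw]
      have key := hlocus ![|φ 1|, |φ 0|] (by simp) (by simpa using hle) (by simpa using hb)
      simp only [Matrix.cons_val_zero, Matrix.cons_val_one] at key
      rw [key]
      exact and_comm
  · -- the four diagonal points are the images of `(c, c)` under `1, sr 0, sr 2, sr 2 ∘ sr 0`
    have hpc : p = ![p 0, p 1] := (twist_vec2_eta p).symm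
    have hcone' :
        ∃ m : ℝ, 0 < m ∧ ∃ ρ : ℝ, 0 < ρ ∧ ∀ φ : Fin 2 → ℝ,
          0 < (φ 0 - (fun _ : Fin 2 => c) 0) ^ 2 + (φ 1 - (fun _ : Fin 2 => c) 1) ^ 2 →
          (φ 0 - (fun _ : Fin 2 => c) 0) ^ 2 + (φ 1 - (fun _ : Fin 2 => c) 1) ^ 2 ≤ ρ ^ 2 →
          ∀ ψ χ : Fock (Orb (FermionTorus 2 L)),
            IsGroundStateInSector (spinTwistedHubbardTorus L U φ) N 0 ψ → χ ∈ szSector N 0 →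
            star ψ ⬝ᵥ χ = 0 → star χ ⬝ᵥ χ = 1 →
              Matrix.minEnergyOn (spinTwistedHubbardTorus L U φ) (szSector N 0) +
                  m * Real.sqrt ((φ 0 - (fun _ : Fin 2 => c) 0) ^ 2 + (φ 1 - (fun _ : Fin 2 => c) 1) ^ 2) ≤
                (star χ ⬝ᵥ (spinTwistedHubbardTorus L U φ *ᵥ χ)).re := hcone
    rcases (abs_eq hc0.le).1 hp0 with h0 | h0 <;> rcases (abs_eq hc0.le).1 hp1 with h1 | h1
    · -- p = (c, c)
      have hp : p = fun _ : Fin 2 => c := by funext i; fin_cases i <;> assumption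
      subst hp
      exact ⟨htwo, hcone'⟩
    · -- p = (c, -c) = sr 0 · (c, c)
      have hp : p = ![c, -c] := by rw [hpc, h0, h1]
      subst hp
      refine ⟨?_, ?_⟩
      · simpa using twofold_neg1 L U N (fun _ : Fin 2 => c) htwo
      · simpa using cone_neg1 L U N (fun _ : Fin 2 => c) hcone'
    · -- p = (-c, c) = sr 2 · (c, c)
      have hp : p = ![-c, c] := by rw [hpc, h0, h1]
      subst hp
      refine ⟨?_, ?_⟩
      · simpa using twofold_neg0 L U N (fun _ : Fin 2 => c) htwo
      · simpa using cone_neg0 L U N (fun _ : Fin 2 => c) hcone'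
    · -- p = (-c, -c) = sr 2 · sr 0 · (c, c)
      have hp : p = ![-c, -c] := by rw [hpc, h0, h1]
      subst hp
      refine ⟨?_, ?_⟩
      · have h2 := twofold_neg0 L U N _ (twofold_neg1 L U N (fun _ : Fin 2 => c) htwo)
        simpa using h2
      · have h2 := cone_neg0 L U N _ (cone_neg1 L U N (fun _ : Fin 2 => c) hcone')
        simpa using h2

/-- **The crux reduces to the ONE-POINT conical statement.** `NodalDiracWeakCoupling` (route
NodalDiracTwist, stmt-HubbardSuperconductivity-10370) follows from `stub_conicalCore` of the line
`birth` v6: `(U, δ, κ, L₀, c)`, LOCUS on the fundamental triangle of the `D₄` symmetry of twist space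
and an exactly two-fold conical crossing of the `(N, S^z = 0)`-sector ground state at the single
diagonal twist `(c, c)` — via `conicalQuartet_of_core` (lattice symmetry, this file) and
`nodalDiracWeakCoupling_of_conicalQuartet` (Möbius sign + annulus invariance + the locus seam, landed).
[folklore] -/
theorem nodalDiracWeakCoupling_of_conicalCore
    (hcore :
    ∀ U₀ : ℝ, 0 < U₀ → ∃ U ∈ Set.Ioo (0 : ℝ) U₀, ∃ δ ∈ Set.Icc (1 / 10 : ℝ) (3 / 10),
      ∃ κ : ℝ, 0 < κ ∧ κ < Real.pi ∧ Real.cos κ ≠ 0 ∧ ∀ ε : ℝ, 0 < ε → ∃ L₀ : ℕ,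
        ∀ (L : ℕ) [NeZero L], Even L → L₀ ≤ L → (∀ m : ℤ, ε ≤ |L * κ - m * Real.pi|) →
          ∃ c : ℝ, 0 < c ∧ c < Real.pi ∧ |Real.cos c - Real.cos (L * κ)| ≤ ε ∧
            (∀ φ : Fin 2 → ℝ, 0 ≤ φ 1 → φ 1 ≤ φ 0 → φ 0 ≤ Real.pi →
                ((∃ ψ₁ ψ₂ : Fock (Orb (FermionTorus 2 L)),
                    IsGroundStateInSector (spinTwistedHubbardTorus L U φ) (2 * ⌊(1 - δ) * (L : ℝ) ^ 2 / 2⌋₊) 0 ψ₁ ∧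
                    IsGroundStateInSector (spinTwistedHubbardTorus L U φ) (2 * ⌊(1 - δ) * (L : ℝ) ^ 2 / 2⌋₊) 0 ψ₂ ∧
                    star ψ₁ ⬝ᵥ ψ₂ = 0) ↔ (φ 0 = c ∧ φ 1 = c))) ∧
            (∃ ψ₁ ψ₂ : Fock (Orb (FermionTorus 2 L)),
                IsGroundStateInSector (spinTwistedHubbardTorus L U (fun _ : Fin 2 => c)) (2 * ⌊(1 - δ) * (L : ℝ) ^ 2 / 2⌋₊) 0 ψ₁ ∧
                IsGroundStateInSector (spinTwistedHubbardTorus L U (fun _ : Fin 2 => c)) (2 * ⌊(1 - δ) * (L : ℝ) ^ 2 / 2⌋₊) 0 ψ₂ ∧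
                star ψ₁ ⬝ᵥ ψ₂ = 0 ∧
                ∀ χ : Fock (Orb (FermionTorus 2 L)),
                  IsGroundStateInSector (spinTwistedHubbardTorus L U (fun _ : Fin 2 => c)) (2 * ⌊(1 - δ) * (L : ℝ) ^ 2 / 2⌋₊) 0 χ →
                    ∃ z₁ z₂ : ℂ, χ = z₁ • ψ₁ + z₂ • ψ₂) ∧
            (∃ m : ℝ, 0 < m ∧ ∃ ρ : ℝ, 0 < ρ ∧ ∀ φ : Fin 2 → ℝ,
                0 < (φ 0 - c) ^ 2 + (φ 1 - c) ^ 2 →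
                (φ 0 - c) ^ 2 + (φ 1 - c) ^ 2 ≤ ρ ^ 2 →
                ∀ ψ χ : Fock (Orb (FermionTorus 2 L)),
                  IsGroundStateInSector (spinTwistedHubbardTorus L U φ) (2 * ⌊(1 - δ) * (L : ℝ) ^ 2 / 2⌋₊) 0 ψ →
                  χ ∈ szSector (2 * ⌊(1 - δ) * (L : ℝ) ^ 2 / 2⌋₊) 0 → star ψ ⬝ᵥ χ = 0 → star χ ⬝ᵥ χ = 1 →
                    Matrix.minEnergyOn (spinTwistedHubbardTorus L U φ) (szSector (2 * ⌊(1 - δ) * (L : ℝ) ^ 2 / 2⌋₊) 0) +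
                        m * Real.sqrt ((φ 0 - c) ^ 2 + (φ 1 - c) ^ 2) ≤
                      (star χ ⬝ᵥ (spinTwistedHubbardTorus L U φ *ᵥ χ)).re)) :
    NodalDiracWeakCoupling :=
  nodalDiracWeakCoupling_of_conicalQuartet (conicalQuartet_of_core hcore)

end Summit.HubbardSuperconductivity.HubbardSuperconductivity.Theorems.NodalDiracTwist

end
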